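import Mathlib

/-!
# Hodge-locus census — arithmetic skeleton of COROLLARY CELLS and PROPOSITION D3-II (ENGINE B, gen 32, record §13c)

Certified instances and evidence bearing on the general Hodge conjecture; no claim.

For the two-plane cell `(2p, d, m)` (two `p`-planes in a smooth hypersurface of degree `d` in
`ℙ^{2p+1}` meeting in a `ℙ^m`) write `c' = p - m` (plane codimension of the intersection) and
`k' = m + 1`.  On the basis THEOREM CS + THEOREM K⁼ of the record, `b(X) = H_B(t-d) - ρ(X)` with
`H_B` the Hilbert function of a complete intersection of `k'` forms of degree `d-1`, of socle degree
`s = k'(d-2)`, and `t - d = s - (d - c'(d-2))`; hence, for `m ≥ 0` and apart from the cell `(2,3,0)`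
(where `t < d`), `H_B(t-d) > 0 ⟺ c'(d-2) ≤ d`, and `b ≡ 0` in every other cell.  For disjoint planes (`m = -1`, `B = K`) the jump is
`b ≡ [(p+1)(d-2) = d]`.  PROPOSITION D3-II (`c' = 2`, `d = 3`) gives
`b ∈ {n ≤ k' | n ≤ 2 ∨ n = k'} ∩ [k' - C(k',3), k']`.
This file kernel-checks the integer facts behind the case list of COROLLARY CELLS:
which `(c', d)` satisfy `c'(d-2) ≤ d`, which `(p, d)` satisfy `(p+1)(d-2) = d`, that
`k - C(k,3) = 0` for `k ≥ 4` (so the lower bound of D3-II is vacuous there), and the resulting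
D3-II value sets `{1}, {2}, {2,3}, {0,1,2,k'}` for `k' = 1, 2, 3, ≥ 4`.  Nothing here formalises the
commutative algebra or the geometry; it pins the integers and sets the paper proof produces.
-/

namespace Summit.HodgeConjecture.HodgeConjecture.HodgeLocus.Census.Cells

/-- The non-void criterion: for `c ≥ 1`, `d ≥ 3`, `c(d-2) ≤ d` holds exactly for `c = 1` (all `d`),
`c = 2` with `d ≤ 4`, and `c = 3` with `d = 3`. -/
theorem nonvoid_iff (c d : ℕ) (hc : 1 ≤ c) (hd : 3 ≤ d) :
    c * (d - 2) ≤ d ↔ c = 1 ∨ (c = 2 ∧ d ≤ 4) ∨ (c = 3 ∧ d = 3) := by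
  obtain ⟨e, rfl⟩ : ∃ e, d = e + 2 := ⟨d - 2, by omega⟩
  simp only [Nat.add_sub_cancel]
  constructor
  · intro h
    rcases Nat.lt_or_ge c 4 with h4 | h4
    · interval_cases c <;> omega
    · nlinarith
  · rintro (rfl | ⟨rfl, h⟩ | ⟨rfl, h⟩) <;> omega

/-- The disjoint-planes criterion: for `p ≥ 1`, `d ≥ 3`, `(p+1)(d-2) = d` holds exactly for
`(p, d) = (2, 3)` (two disjoint planes in a cubic fourfold) and `(p, d) = (1, 4)`
(two disjoint lines on a quartic surface). -/
theorem disjoint_jump_iff (p d : ℕ) (hp : 1 ≤ p) (hd : 3 ≤ d) :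
    (p + 1) * (d - 2) = d ↔ (p = 2 ∧ d = 3) ∨ (p = 1 ∧ d = 4) := by
  obtain ⟨e, rfl⟩ : ∃ e, d = e + 2 := ⟨d - 2, by omega⟩
  simp only [Nat.add_sub_cancel]
  constructor
  · intro h
    rcases Nat.lt_or_ge p 3 with h3 | h3
    · interval_cases p <;> omega
    · nlinarith
  · rintro (⟨rfl, h⟩ | ⟨rfl, h⟩) <;> omega

/-- `k - C(k,3) = 0` for `k ≥ 4` (truncated subtraction): the lower bound `b ≥ k' - C(k',3)` of
PROPOSITION D3-II (ii) is vacuous from `k' = 4` on.  (Pascal's rule and induction from `C(4,3) = 4`.) -/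
theorem sub_choose_three_eq_zero {k : ℕ} (hk : 4 ≤ k) : k - k.choose 3 = 0 := by
  suffices h : k ≤ k.choose 3 by omega
  induction k, hk using Nat.le_induction with
  | base => decide
  | succ n hn ih =>
    have h2 : 1 ≤ n.choose 2 := Nat.choose_pos (by omega)
    have h3 : (n + 1).choose 3 = n.choose 2 + n.choose 3 := Nat.choose_succ_succ' n 2
    omega

/-- The D3-II value set in the cell with `k' = k`: the `n ≤ k` with `n ≤ 2 ∨ n = k` (Gorenstein
step) and `k - C(k,3) ≤ n` (rank bound `ρ ≤ dim B_3`). -/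
def d3IISet (k : ℕ) : Finset ℕ :=
  (Finset.range (k + 1)).filter (fun n => (n ≤ 2 ∨ n = k) ∧ k - k.choose 3 ≤ n)

/-- Membership unfolded. -/
theorem mem_d3IISet (k n : ℕ) :
    n ∈ d3IISet k ↔ n ≤ k ∧ (n ≤ 2 ∨ n = k) ∧ k - k.choose 3 ≤ n := by
  simp [d3IISet]

/-- `k' = 1, 2, 3` (cells `(4,3,0)`, `(6,3,1)`, `(8,3,2)`): the value sets are `{1}`, `{2}`, `{2,3}`. -/
theorem d3IISet_small : d3IISet 1 = {1} ∧ d3IISet 2 = {2} ∧ d3IISet 3 = {2, 3} := by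
  decide

/-- `k' ≥ 4` (cells `(2p,3,p-2)`, `p ≥ 5`): the value set is `{0, 1, 2, k'}`. -/
theorem mem_d3IISet_ge_four {k : ℕ} (hk : 4 ≤ k) (n : ℕ) :
    n ∈ d3IISet k ↔ n = 0 ∨ n = 1 ∨ n = 2 ∨ n = k := by
  have hc := sub_choose_three_eq_zero hk
  rw [mem_d3IISet]
  constructor
  · rintro ⟨h1, h2 | h2, -⟩ <;> omega
  · rintro (rfl | rfl | rfl | rfl) <;> exact ⟨by omega, by omega, by omega⟩

/-- Instances matching the census rows: `(10,3,3)` has `k' = 4`, value set `{0,1,2,4}`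
(certified `b_gen = 0`; `3` excluded); the `m ≥ 0` non-void cells are `c' ≤ 3` for cubics,
`c' ≤ 2` for quartics, and only `c' = 1` for `d ≥ 5`. -/
theorem cells_instances :
    d3IISet 4 = {0, 1, 2, 4} ∧
    (3 * (3 - 2) ≤ 3 ∧ ¬ 4 * (3 - 2) ≤ 3) ∧ (2 * (4 - 2) ≤ 4 ∧ ¬ 3 * (4 - 2) ≤ 4) ∧
    (1 * (5 - 2) ≤ 5 ∧ ¬ 2 * (5 - 2) ≤ 5) := by
  decide

end Summit.HodgeConjecture.HodgeConjecture.HodgeLocus.Census.Cells
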